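import Literature.AnabelianGeometry.EtaleTheta.RigidOfSetting
import Literature.AnabelianGeometry.AbsoluteAnabelian.MLFSlimKummerProofs
import HarnessLib

/-!
# [EtTh] §2 over §1: "`G_K` is center-free" — UNCONDITIONAL (merge pass of the adapter W2-L2-04)

Mochizuki, *The étale theta function …*, Publ. RIMS **45** (2009), proof of Prop. 2.14 (i), PRIMS PDF
p. 50 (printed 276): "since `G_K` is center-free — cf., e.g., [Mzk2], Theorem 1.1.1, (ii)"
[cite: MochizukiEtTh2009, Prop 2.14 (i) p.50]. Layer L2 of the abc-iut cell, seat abc-iut-L2-t8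
(gen 2), PROOF-ONLY merge pass (plan/L2/ASSIGNMENTS.md §C.5/§H(1)) of the adapter files
`GKCenterFree.lean` (p406825) and `RigidOfSetting.lean` (p409073):

those files took [AbsAnab] Thm. 1.1.1 (ii) as the HYPOTHESIS `(hslim : galoisMLF_slim)` (the tree's
named fact, `AbsoluteAnabelian/MLFGaloisGroups.lean`). Since then the fact has been PROVED in the tree
(`AbsoluteAnabelian.galoisMLF_slim_holds`, `MLFSlimKummerProofs.lean`, seat abc-iut-L4-d2, p407463:
a reciprocity-free Kummer-theoretic proof). This file discharges the hypothesis: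

* `ThetaSetting.GK_center_free_holds` — an element of `G_K ≤ G_{ℚ_p}` central in `G_K` is trivial;
* `EtaleThetaData.DoubleUnderline.aug_eq_one_of_forall_conj_holds` — the input `(hslim)` of the §2
  discharge files (seat abc-iut-L2-t10: an element of `Π^tp_X̲̲` whose image in `G_K` commutes with the
  image of `Π^tp_Y̲̲` has trivial image), now hypothesis-free over the §1 model `thetaEnvData`.

HONEST FRAMING: classical Galois theory of `p`-adic fields, OUR kernel check; nothing here concerns
the disputed parts of IUT; no side is taken on [IUTchIII] Cor. 3.12.
-/

noncomputable section

namespace Literature.AnabelianGeometry.EtaleTheta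

open Literature.AnabelianGeometry.SemiGraphs
open Literature.AnabelianGeometry.AbsoluteAnabelian (galoisMLF_slim galoisMLF_slim_holds)

namespace ThetaSetting

variable {p : ℕ} [Fact p.Prime] (D : ThetaSetting p)

/-- **"`G_K` is center-free"** for the base field of the theta setting ([AbsAnab] Thm. 1.1.1 (ii), as
quoted in the proof of [EtTh] Prop. 2.14 (i), p. 50) — UNCONDITIONAL: an element of
`G_K = K.fixingSubgroup ≤ G_{ℚ_p}` commuting with all of `G_K` is trivial.
[cite: MochizukiEtTh2009, Prop 2.14 (i) p.50] -/
theorem GK_center_free_holds : ∀ g ∈ D.GK, (∀ g' ∈ D.GK, g * g' = g' * g) → g = 1 :=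
  D.GK_center_free galoisMLF_slim_holds

/-- The center of `G_K` is trivial (subgroup form of `GK_center_free_holds`).
[cite: MochizukiEtTh2009, Prop 2.14 (i) p.50] -/
theorem center_GK_eq_bot : Subgroup.center D.GK = ⊥ := by
  rw [eq_bot_iff]
  intro g hg
  rw [Subgroup.mem_center_iff] at hg
  rw [Subgroup.mem_bot]
  apply Subtype.ext
  refine D.GK_center_free_holds g g.2 fun g' hg' => ?_
  exact (congrArg Subtype.val (hg ⟨g', hg'⟩)).symm

namespace EtaleThetaData.DoubleUnderline

variable {D} {E : D.EtaleThetaData} {l : ℕ} (C : E.DoubleUnderline l) {N : ℕ+} (μ : D.CyclotomeMod l N)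

/-- **`(hslim)` discharged**: over the §1 model `thetaEnvData`, an element of `Π^tp_X̲̲` whose image in
`G_K` commutes with the image of `Π^tp_Y̲̲` has trivial image in `G_K` — hypothesis-free (the input
`(hslim)` of the §2 discharge files, via `aug_eq_one_of_forall_conj_of_slim` and
`galoisMLF_slim_holds`). [cite: MochizukiEtTh2009, Prop 2.14 (i) p.50] -/
theorem aug_eq_one_of_forall_conj_holds (hC : D.Compat) (hS : D.Sec2Hyps)
    (z : (C.thetaEnvData μ hC hS).PiX)
    (hz : ∀ y : (C.thetaEnvData μ hC hS).PiY,
      (C.thetaEnvData μ hC hS).aug (z * y * z⁻¹) = (C.thetaEnvData μ hC hS).aug y) :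
    (C.thetaEnvData μ hC hS).aug z = 1 :=
  C.aug_eq_one_of_forall_conj_of_slim μ hC hS galoisMLF_slim_holds z hz

end EtaleThetaData.DoubleUnderline

end ThetaSetting

end Literature.AnabelianGeometry.EtaleTheta

end
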